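import Literature.Combinatorics.SimpleGraph.PfaffianDicycles
import HarnessLib

/-!
# Certificates of non-Pfaffian-ness: evenly covering families of directed circuits

Topic `Combinatorics/SimpleGraph`; theorems only. Tools for the hard direction of Little's theorem
(`Little1975_isPfaffianBipartite_iff_not_isMatchingMinor`, `LittleTheorem.lean`).

Little (1973, 1975 §2) and Fischer–Little (2001, Lemma 2.2: "a graph is Pfaffian iff it has no
INTRACTABLE set of alternating circuits") certify non-Pfaffian-ness by a family of alternating
circuits covering every edge an even number of times, an odd number of whose members are evenly
oriented — the latter parity being independent of the orientation because of the former
property. In the language of `PfaffianDicycles.lean` (reference matching = the diagonal of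
`G ⊆ Fin n × Fin n`, directed circuits = cyclic permutations `γ` inside `G`, weight of `γ` under a
signing `s` = `sign γ * ∏ i, s (i, γ i)`):

* `prod_weight_eq_prod_sign` — if a list `F` of permutations covers every off-diagonal cell
  `(a, b)` an even number of times (`Even (F.countP (· a = b))`), then for EVERY signing `s` with
  `s (i, i) = 1` the product of the weights of the members of `F` equals the product of their
  signs (each `s (a, b)`, `a ≠ b`, enters an even number of times);
* `not_isPfaffianBipartite_of_certificate` — **hence, if moreover every member is a cyclic
  permutation inside `G ⊇ diagonal` and the product of the signs is `-1`, then `G` is not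
  Pfaffian** (under a normalised Pólya signing every member would have weight `+1`,
  `isPfaffianBipartite_iff_forall_isCycle`). This is the "intractable set" criterion, direction
  used in minimality arguments (Fischer–Little 2001, proof of Theorem 2.2).

## References

* C. H. C. Little, *A characterization of convertible (0,1)-matrices*, J. Combin. Theory Ser. B
  18 (1975) 187–208, §2. [Little1975]
* I. Fischer, C. H. C. Little, *A characterisation of Pfaffian near bipartite graphs*, J. Combin.
  Theory Ser. B 82 (2001) 175–222, Lemma 2.2, Lemma 2.8, Theorem 2.2. [FischerLittle2001]
-/

namespace Literature.Combinatorics.SimpleGraph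

open Equiv Finset

variable {n : ℕ}

/-- Products over a list and over `Fin n` commute. [folklore] -/
theorem list_prod_map_prod_comm {M : Type*} [CommMonoid M] (F : List (Perm (Fin n)))
    (f : Perm (Fin n) → Fin n → M) :
    (F.map fun γ => ∏ i, f γ i).prod = ∏ i, (F.map fun γ => f γ i).prod := by
  induction F with
  | nil => simp
  | cons γ F ih => rw [List.map_cons, List.prod_cons, ih, ← Finset.prod_mul_distrib]; rfl

/-- Grouping a product over a list by the values of `γ i`: every value `b` contributes
`f b ^ (number of members with γ i = b)`. [folklore] -/
theorem list_prod_map_eq_prod_pow_countP {M : Type*} [CommMonoid M] (F : List (Perm (Fin n)))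
    (i : Fin n) (f : Fin n → M) :
    (F.map fun γ => f (γ i)).prod = ∏ b, f b ^ F.countP (fun γ => γ i = b) := by
  induction F with
  | nil => simp
  | cons γ F ih =>
    rw [List.map_cons, List.prod_cons, ih]
    rw [← Finset.mul_prod_erase Finset.univ _ (Finset.mem_univ (γ i)),
      ← Finset.mul_prod_erase Finset.univ (fun b => f b ^ (γ :: F).countP (fun γ' => γ' i = b))
        (Finset.mem_univ (γ i))]
    have h1 : (γ :: F).countP (fun γ' => γ' i = γ i) = F.countP (fun γ' => γ' i = γ i) + 1 := by
      rw [List.countP_cons_of_pos]; simp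
    have h2 : ∀ b ∈ Finset.univ.erase (γ i),
        f b ^ (γ :: F).countP (fun γ' => γ' i = b) = f b ^ F.countP (fun γ' => γ' i = b) := by
      intro b hb
      rw [List.countP_cons_of_neg]
      simpa [eq_comm] using Finset.ne_of_mem_erase hb
    rw [Finset.prod_congr rfl h2, h1, pow_succ]
    simp only [mul_comm, mul_left_comm]

/-- **Even coverage makes the total weight independent of the signing.** If every off-diagonal
cell `(a, b)` is a cell of an even number of members of `F` (counted by `γ a = b`), then for
every signing `s` with `s (i, i) = 1`:
`∏_{γ ∈ F} (sign γ * ∏ i, s (i, γ i)) = ∏_{γ ∈ F} sign γ` (Fischer–Little 2001, Lemma 2.8: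
"the parity of the number of clockwise even members is independent of the orientation").
[cite: FischerLittle2001, Lemma 2.8] -/
theorem prod_weight_eq_prod_sign (F : List (Perm (Fin n)))
    (heven : ∀ a b : Fin n, a ≠ b → Even (F.countP fun γ => γ a = b))
    (s : Fin n × Fin n → ℤˣ) (h1 : ∀ i, s (i, i) = 1) :
    (F.map fun γ => Perm.sign γ * ∏ i, s (i, γ i)).prod =
      (F.map fun γ => (Perm.sign γ : ℤˣ)).prod := by
  rw [List.prod_map_mul]
  suffices hW : (F.map fun γ => ∏ i, s (i, γ i)).prod = 1 by rw [hW, mul_one]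
  rw [list_prod_map_prod_comm F (fun γ i => s (i, γ i))]
  refine Finset.prod_eq_one fun i _ => ?_
  rw [list_prod_map_eq_prod_pow_countP F i (fun b => s (i, b))]
  refine Finset.prod_eq_one fun b _ => ?_
  by_cases hib : i = b
  · subst hib; rw [h1, one_pow]
  · obtain ⟨k, hk⟩ := heven i b hib
    rw [hk, pow_add, ← mul_pow, Int.units_mul_self, one_pow]

/-- **The certificate of non-Pfaffian-ness** (Little's / Fischer–Little's "intractable set of
alternating circuits", for the diagonal reference matching): let `G ⊇ diagonal`, and let `F` be a
list of CYCLIC permutations inside `G` (directed circuits of `D(G, M)`) covering every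
off-diagonal cell an even number of times, whose signs multiply to `-1`. Then `G` is not
Pfaffian: a normalised Pólya signing would give every member weight `+1`
(`isPfaffianBipartite_iff_forall_isCycle`), yet the total weight is the product of the signs
(`prod_weight_eq_prod_sign`). [cite: FischerLittle2001, Lemma 2.2] -/
theorem not_isPfaffianBipartite_of_certificate {G : Finset (Fin n × Fin n)}
    (hdiag : ∀ i, (i, i) ∈ G) (F : List (Perm (Fin n))) (hcyc : ∀ γ ∈ F, γ.IsCycle)
    (hmem : ∀ γ ∈ F, ∀ i, (i, γ i) ∈ G)
    (heven : ∀ a b : Fin n, a ≠ b → Even (F.countP fun γ => γ a = b))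
    (hsign : (F.map fun γ => (Perm.sign γ : ℤˣ)).prod = -1) : ¬ IsPfaffianBipartite G := by
  intro hP
  obtain ⟨s, h1, hpos⟩ := (isPfaffianBipartite_iff_forall_isCycle hdiag).1 hP
  have hall : (F.map fun γ => Perm.sign γ * ∏ i, s (i, γ i)).prod = 1 := by
    apply List.prod_eq_one
    intro x hx
    obtain ⟨γ, hγ, rfl⟩ := List.mem_map.1 hx
    exact hpos γ (hcyc γ hγ) (hmem γ hγ)
  rw [prod_weight_eq_prod_sign F heven s h1, hsign] at hall
  exact absurd hall (by decide)

/-- Convenience form for minimality arguments: the certificate proves non-Pfaffian-ness of the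
SMALLEST graph carrying it, the diagonal together with the cells of the members of `F` (a
subgraph of any `G ⊇ diagonal` inside which the members lie). [folklore] -/
theorem not_isPfaffianBipartite_diag_union_cells (F : List (Perm (Fin n)))
    (hcyc : ∀ γ ∈ F, γ.IsCycle)
    (heven : ∀ a b : Fin n, a ≠ b → Even (F.countP fun γ => γ a = b))
    (hsign : (F.map fun γ => (Perm.sign γ : ℤˣ)).prod = -1) :
    ¬ IsPfaffianBipartite ((Finset.univ.image fun i : Fin n => (i, i)) ∪
        Finset.univ.filter fun e : Fin n × Fin n => ∃ γ ∈ F, γ e.1 = e.2) := by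
  classical
  refine not_isPfaffianBipartite_of_certificate (fun i => ?_) F hcyc (fun γ hγ i => ?_) heven hsign
  · exact Finset.mem_union_left _ (Finset.mem_image.2 ⟨i, Finset.mem_univ _, rfl⟩)
  · exact Finset.mem_union_right _ (Finset.mem_filter.2 ⟨Finset.mem_univ _, γ, hγ, rfl⟩)

end Literature.Combinatorics.SimpleGraph
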